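import Literature.Analysis.Fourier.ChirpPhase
import HarnessLib

/-!
# The trapezoidal cell identity and the level points of a chirp

Preliminaries of the second-order Euler–Maclaurin formula along the level set of a chirp phase
(`ChirpEulerMaclaurin.lean`):
* `cell_identity` — the trapezoidal rule with its exact `B₂` remainder on one cell `[a, b]` with
  `φ(a) = m`, `φ(b) = m + 1`, `φ' > 0`:
  `½(F(a)+F(b)) = ∫_a^b [F φ' - (F''/φ' - F'φ''/φ'²) · ((φ-m)² - (φ-m))/2]` (two integrations by
  parts; Olver, *Asymptotics and Special Functions* (1974), Ch. 8 §1.1);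
* the level points `γ_n ≥ H`, `φ(γ_n) = n` of a chirp phase with `φ(H) = 0`: strictly increasing,
  `γ₀ = H`, `γ_n → ∞`, the cells `(γ_n, γ_{n+1}]` partition `(H, ∞)`, and `n ≤ C(1 + γ_n²)`.
All proved, no named facts.
-/

noncomputable section

open Set Filter MeasureTheory
open scoped Topology ContDiff Real

namespace Literature.Analysis.Fourier

open _root_.Complex (I exp)

/-! ## The cell identity -/

/-- **Trapezoidal rule with exact `B₂` remainder on one cell** `[a, b]` with `φ(a) = m`,
`φ(b) = m + 1`, `φ' > 0`: `½(F(a) + F(b)) = ∫_a^b F φ' - ∫_a^b (F''/φ' - F'φ''/φ'²) q(φ - m)`,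
`q(x) = (x² - x)/2` (two integrations by parts). [folklore] -/
theorem cell_identity {φ : ℝ → ℝ} {F F₁ F₂ : ℝ → ℂ} {a b : ℝ} {m : ℝ} (hab : a ≤ b)
    (hφ : ContDiff ℝ ∞ φ) (hpos : ∀ t ∈ Icc a b, 0 < deriv φ t) (hφa : φ a = m)
    (hφb : φ b = m + 1) (hF : ∀ t, HasDerivAt F (F₁ t) t) (hF₁ : ∀ t, HasDerivAt F₁ (F₂ t) t)
    (hF₂c : Continuous F₂) :
    (F a + F b) / 2 = ∫ t in a..b, (F t * ((deriv φ t : ℝ) : ℂ) -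
      (F₂ t * ((deriv φ t)⁻¹ : ℝ) -
        F₁ t * ((deriv (deriv φ) t * (deriv φ t)⁻¹ * (deriv φ t)⁻¹ : ℝ) : ℂ)) *
        ((((φ t - m) ^ 2 - (φ t - m)) / 2 : ℝ) : ℂ)) := by
  have huIcc : uIcc a b = Icc a b := uIcc_of_le hab
  have hφd : ∀ t, HasDerivAt φ (deriv φ t) t := fun t =>
    ((hφ.differentiable (by simp)) t).hasDerivAt
  have hφ'sm : ContDiff ℝ ∞ (deriv φ) := (contDiff_infty_iff_deriv.1 hφ).2
  have hφd2 : ∀ t, HasDerivAt (deriv φ) (deriv (deriv φ) t) t := fun t =>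
    ((hφ'sm.differentiable (by simp)) t).hasDerivAt
  have hφ''c : Continuous (deriv (deriv φ)) := (contDiff_infty_iff_deriv.1 hφ'sm).2.continuous
  have hFc : Continuous F := continuous_iff_continuousAt.2 fun t => (hF t).continuousAt
  have hF₁c : Continuous F₁ := continuous_iff_continuousAt.2 fun t => (hF₁ t).continuousAt
  -- second integration by parts: `∫ F₁ (φ - m - 1/2) = (F a + F b)/2 - ∫ F φ'`
  set V : ℝ → ℂ := fun t => ((φ t : ℂ) - m - 1 / 2) with hV
  have hVd : ∀ t, HasDerivAt V ((deriv φ t : ℝ) : ℂ) t := fun t => by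
    have := ((hφd t).ofReal_comp).sub_const ((m : ℂ) + 1 / 2)
    simpa [hV, sub_sub] using this
  have ibp2 := intervalIntegral.integral_mul_deriv_eq_deriv_mul (a := a) (b := b) (u := V)
    (v := F) (u' := fun t => ((deriv φ t : ℝ) : ℂ)) (v' := F₁) (fun t _ => hVd t) (fun t _ => hF t)
    ((Complex.continuous_ofReal.comp hφ'sm.continuous).intervalIntegrable a b)
    (hF₁c.intervalIntegrable a b)
  have hVa : V a = -(1 / 2) := by simp [hV, hφa]
  have hVb : V b = 1 / 2 := by rw [hV]; simp only [hφb]; push_cast; ring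
  rw [hVa, hVb] at ibp2
  -- first integration by parts: `∫ (F₁/φ')' q = - ∫ F₁ (φ - m - 1/2)`
  set u : ℝ → ℂ := fun t => F₁ t / ((deriv φ t : ℝ) : ℂ) with hu
  set u' : ℝ → ℂ := fun t => F₂ t * ((deriv φ t)⁻¹ : ℝ) -
    F₁ t * ((deriv (deriv φ) t * (deriv φ t)⁻¹ * (deriv φ t)⁻¹ : ℝ) : ℂ) with hu'
  set q : ℝ → ℂ := fun t => ((((φ t - m) ^ 2 - (φ t - m)) / 2 : ℝ) : ℂ) with hq
  set q' : ℝ → ℂ := fun t => V t * ((deriv φ t : ℝ) : ℂ) with hq'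
  have hud : ∀ t ∈ uIcc a b, HasDerivAt u (u' t) t := by
    intro t ht
    rw [huIcc] at ht
    have hp : ((deriv φ t : ℝ) : ℂ) ≠ 0 := Complex.ofReal_ne_zero.mpr (hpos t ht).ne'
    have h1 := (hF₁ t).fun_div (hφd2 t).ofReal_comp hp
    refine h1.congr_deriv ?_
    rw [hu']
    push_cast
    field_simp
  have hqd : ∀ t ∈ uIcc a b, HasDerivAt q (q' t) t := by
    intro t _
    have h2 := (hφd t).sub_const m
    have h1 : HasDerivAt (fun t => ((φ t - m) ^ 2 - (φ t - m)) / 2)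
        (((2 : ℕ) * (φ t - m) ^ (2 - 1) * deriv φ t - deriv φ t) / 2) t :=
      ((h2.pow 2).sub h2).div_const 2
    refine (h1.ofReal_comp).congr_deriv ?_
    rw [hq', hV]
    push_cast
    ring
  have hu'c : ContinuousOn u' (uIcc a b) := by
    rw [huIcc]
    have hne : ∀ t ∈ Icc a b, deriv φ t ≠ 0 := fun t ht => (hpos t ht).ne'
    apply ContinuousOn.sub
    · exact hF₂c.continuousOn.mul (Complex.continuous_ofReal.comp_continuousOn
        (hφ'sm.continuous.continuousOn.inv₀ hne))
    · refine hF₁c.continuousOn.mul (Complex.continuous_ofReal.comp_continuousOn ?_)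
      exact (hφ''c.continuousOn.mul (hφ'sm.continuous.continuousOn.inv₀ hne)).mul
        (hφ'sm.continuous.continuousOn.inv₀ hne)
  have hu'i : IntervalIntegrable u' volume a b := by
    rw [huIcc] at hu'c
    exact hu'c.intervalIntegrable_of_Icc hab
  have hq'c : Continuous q' := by
    simp only [hq', hV]
    exact ((Complex.continuous_ofReal.comp hφ.continuous).sub continuous_const |>.sub
      continuous_const).mul (Complex.continuous_ofReal.comp hφ'sm.continuous)
  have ibp1 := intervalIntegral.integral_mul_deriv_eq_deriv_mul hud hqd hu'i
    (hq'c.intervalIntegrable _ _)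
  have hqa : q a = 0 := by simp [hq, hφa]
  have hqb : q b = 0 := by rw [hq]; simp only [hφb]; push_cast; ring
  rw [hqa, hqb, mul_zero, mul_zero, sub_zero, zero_sub] at ibp1
  -- `u q' = F₁ V`
  have huq : ∀ t ∈ uIcc a b, u t * q' t = V t * F₁ t := by
    intro t ht
    rw [huIcc] at ht
    have hp : ((deriv φ t : ℝ) : ℂ) ≠ 0 := Complex.ofReal_ne_zero.mpr (hpos t ht).ne'
    rw [hu, hq']
    field_simp
  rw [intervalIntegral.integral_congr huq, ibp2] at ibp1
  -- assemble
  have e1 : ∫ t in a..b, ((deriv φ t : ℝ) : ℂ) * F t = ∫ t in a..b, F t * ((deriv φ t : ℝ) : ℂ) :=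
    intervalIntegral.integral_congr fun t _ => by ring
  rw [e1] at ibp1
  have hqc : Continuous q := by
    simp only [hq]
    exact Complex.continuous_ofReal.comp (((hφ.continuous.sub continuous_const).pow 2 |>.sub
      (hφ.continuous.sub continuous_const)).div_const _)
  have hI1 : IntervalIntegrable (fun t => F t * ((deriv φ t : ℝ) : ℂ)) volume a b :=
    (hFc.mul (Complex.continuous_ofReal.comp hφ'sm.continuous)).intervalIntegrable _ _
  have hI2 : IntervalIntegrable (fun t => u' t * q t) volume a b := by
    rw [huIcc] at hu'c
    exact (hu'c.mul hqc.continuousOn).intervalIntegrable_of_Icc hab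
  rw [intervalIntegral.integral_sub hI1 hI2]
  show (F a + F b) / 2 = (∫ t in a..b, F t * ((deriv φ t : ℝ) : ℂ)) - ∫ t in a..b, u' t * q t
  linear_combination ibp1

/-! ## The level points of the chirp -/

section levelSet

variable {φ : ℝ → ℝ} {H L : ℝ} {Cφ : ℕ → ℝ} (hφ : ChirpPhase φ H L Cφ) (hφH : φ H = 0)
  {γ : ℕ → ℝ} (hγ : ∀ n, H ≤ γ n ∧ φ (γ n) = n)
include hφ

/-- `φ` is strictly increasing on `[H, ∞)`. [folklore] -/
theorem ChirpPhase.strictMonoOn : StrictMonoOn φ (Ici H) :=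
  strictMonoOn_of_deriv_pos (convex_Ici H) hφ.smooth.continuous.continuousOn fun t ht => by
    rw [interior_Ici] at ht
    exact hφ.pos.trans_le (hφ.deriv_ge t (le_of_lt ht))

include hγ

/-- The level points are strictly increasing. [folklore] -/
theorem ChirpPhase.strictMono_level : StrictMono γ := by
  refine strictMono_nat_of_lt_succ fun n => ?_
  have h := (hφ.strictMonoOn.lt_iff_lt (hγ n).1 (hγ (n + 1)).1).1
  apply h
  rw [(hγ n).2, (hγ (n + 1)).2]
  push_cast
  linarith

include hφH in
/-- `γ₀ = H`. [folklore] -/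
theorem ChirpPhase.level_zero : γ 0 = H := by
  have h := hφ.strictMonoOn.injOn (hγ 0).1 (self_mem_Ici (a := H))
  apply h
  rw [(hγ 0).2, hφH]
  simp

/-- The level points tend to infinity. [folklore] -/
theorem ChirpPhase.tendsto_level : Tendsto γ atTop atTop := by
  refine tendsto_atTop_atTop.2 fun b => ⟨⌈φ (max b H)⌉₊ + 1, fun n hn => ?_⟩
  by_contra h
  push Not at h
  have h1 : γ n ≤ max b H := h.le.trans (le_max_left _ _)
  have h2 : φ (γ n) ≤ φ (max b H) := hφ.strictMonoOn.monotoneOn (hγ n).1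
    (le_max_right b H : H ≤ max b H) h1
  rw [(hγ n).2] at h2
  have h3 : (⌈φ (max b H)⌉₊ : ℝ) + 1 ≤ n := by exact_mod_cast hn
  linarith [Nat.le_ceil (φ (max b H))]

include hφH in
/-- The cells `(γ_n, γ_{n+1}]` cover `(H, ∞)`. [folklore] -/
theorem ChirpPhase.iUnion_cells : ⋃ n : ℕ, Ioc (γ n) (γ (n + 1)) = Ioi H := by
  have h0 := hφ.level_zero hφH hγ
  have hsm := hφ.strictMono_level hγ
  ext x
  simp only [mem_iUnion, mem_Ioc, mem_Ioi]
  constructor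
  · rintro ⟨n, hn, _⟩
    exact lt_of_le_of_lt (h0 ▸ hsm.monotone (Nat.zero_le n)) hn
  · intro hx
    -- `N` = first index with `x ≤ γ N`; it is positive since `γ 0 = H < x`
    have hex : ∃ N, x ≤ γ N := by
      have := (hφ.tendsto_level hγ).eventually (eventually_ge_atTop x)
      exact this.exists
    classical
    let N := Nat.find hex
    have hN : x ≤ γ N := Nat.find_spec hex
    have hN0 : N ≠ 0 := by
      intro hz
      have : x ≤ γ 0 := by simpa [hz] using hN
      rw [h0] at this
      linarith
    obtain ⟨n, hn⟩ := Nat.exists_eq_succ_of_ne_zero hN0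
    refine ⟨n, ?_, by simpa [hn] using hN⟩
    have := Nat.find_min hex (show n < N by omega)
    push Not at this
    exact this

include hφH in
/-- The growth of the level points: `n ≤ C (1 + γ_n²)`. [folklore] -/
theorem ChirpPhase.exists_level_growth : ∃ C, 0 < C ∧ ∀ n : ℕ, (n : ℝ) ≤ C * (1 + γ n ^ 2) := by
  set C₁ := max (Cφ 1) 0 with hC₁
  refine ⟨2 * C₁ + 1, by positivity, fun n => ?_⟩
  obtain ⟨hHn, hφn⟩ := hγ n
  have hγ1 : 1 ≤ γ n := hφ.one_le.trans hHn
  -- mean value inequality on `[H, γ n]` with the slope bound `C₁ log(γ_n + 2)`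
  have hslope : ∀ x ∈ interior (Icc H (γ n)), deriv φ x ≤ C₁ * Real.log (γ n + 2) := by
    intro x hx
    rw [interior_Icc] at hx
    have h1 := hφ.abs_iteratedDeriv_le (le_refl 1) hx.1
    simp only [iteratedDeriv_one, Nat.cast_one, sub_self, Real.rpow_zero, mul_one] at h1
    have h2 : Real.log (x + 2) ≤ Real.log (γ n + 2) :=
      Real.log_le_log (by linarith [hφ.one_le, hx.1]) (by linarith [hx.2])
    calc deriv φ x ≤ |deriv φ x| := le_abs_self _
      _ ≤ C₁ * Real.log (x + 2) := h1
      _ ≤ C₁ * Real.log (γ n + 2) := mul_le_mul_of_nonneg_left h2 (le_max_right _ _)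
  have hmv := (convex_Icc H (γ n)).image_sub_le_mul_sub_of_deriv_le
    hφ.smooth.continuous.continuousOn (hφ.smooth.differentiable (by simp)).differentiableOn
    hslope H (left_mem_Icc.2 hHn) (γ n) (right_mem_Icc.2 hHn) hHn
  rw [hφn, hφH, sub_zero] at hmv
  have hlog : Real.log (γ n + 2) ≤ γ n + 1 := by
    have := Real.log_le_sub_one_of_pos (by linarith : 0 < γ n + 2); linarith
  have hC₁0 : 0 ≤ C₁ := le_max_right _ _
  have h3 : (n : ℝ) ≤ C₁ * (γ n + 1) * γ n := by
    calc (n : ℝ) ≤ C₁ * Real.log (γ n + 2) * (γ n - H) := hmv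
      _ ≤ C₁ * (γ n + 1) * γ n := by
          apply mul_le_mul (mul_le_mul_of_nonneg_left hlog hC₁0) (by linarith [hφ.one_le])
            (by linarith) (by positivity)
  nlinarith [sq_nonneg (γ n - 1)]

end levelSet

end Literature.Analysis.Fourier
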